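import Mathlib
import Summits.KontsevichZagierPeriods.Zeta5Search.WedgeDictionary
import HarnessLib

/-!
# The wedge-square dictionary: kernel-checked instance of the `Q`-identity at `a = 2⁸` (`Q₂ = 2989`)

Cell `pub-zeta5` (HONEST FRAMING: systematic search; no irrationality claim unless certified), typer seat
generation 3.  OUR work (Summit side); companion of `WedgeDictionaryInstances.lean` (instances `a = 1⁸`, `a = (2,1⁷)`),
same recipe: explicit partial-fraction tables certified as THE data of `R_b` (`IsPFData`, by `field_simp; ring`),
canonical coefficients through `coeffU_eq`/`coeffW_eq`, `Q(a)` of (17) by `decide`, `ρ(a)` by the kernel.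

`a = 2⁸` is Brown–Zudilin's totally symmetric case `n = 2` (arXiv:2210.03391, §2, (5): `Q₂ = 2989`,
`P̂₂ = 344923/96`, `P₂ = 1190161/384`):  `b = b(2⁸) = (6; 2⁷)`, partner `b′ = (6; 3, 2⁶)`, `ρ = 32/3`,
`(U, W) = (469/8, 6125/32)`, `(U′, W′) = (−69, −441/2)` and `Q(2⁸) = 2989 = ρ(UW′ − U′W)` (`Q_identity_twos`).  The
independent script `HOME/code/typer/pfdata.py` (same conventions as the Lean definitions) also returns the printed
`P̂₂ = ρ(UV′ − U′V)` and `P₂ = ρ(W′V − WV′)` — the `I`-part of the conjecture agrees with the printed decomposition (5)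
at `n = 1, 2` (not a Lean statement: it concerns the integral).
-/

noncomputable section

open Finset Polynomial

namespace Summit.KontsevichZagierPeriods.Zeta5Search.WedgeDictionary

open Summit.KontsevichZagierPeriods.Zeta5Search.DualSeries
open Literature.NumberTheory.Irrationality.BrownZudilin2022 (bOfA QOf Converges)
open Literature.NumberTheory.Transcendental.BallRivoal (pfEval)

/-! ### The vectors, the tables, the instance -/

/-- `b = (6; 2,2,2,2,2,2,2) = b(2⁸)`. -/
def bSym2 : ℕ → ℤ := fun j => if j = 0 then 6 else if j ≤ 7 then 2 else 0

/-- `b′ = (6; 3,2,2,2,2,2,2) = b(2⁸) + e₁`. -/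
def bSym2p : ℕ → ℤ := fun j => if j = 0 then 6 else if j = 1 then 3 else if j ≤ 7 then 2 else 0

/-- `b(2⁸) = (6; 2⁷)`. -/
theorem bOfA_twos : bOfA ![2, 2, 2, 2, 2, 2, 2, 2] = bSym2 := by
  funext j
  match j with
  | 0 => rfl | 1 => rfl | 2 => rfl | 3 => rfl | 4 => rfl | 5 => rfl | 6 => rfl | 7 => rfl
  | n + 8 => simp [bOfA, bSym2]

/-- The partner shift `j = 1` of `(6; 2⁷)` is `(6; 3, 2⁶)`. -/
theorem update_bSym2 : Function.update bSym2 1 (bSym2 1 + 1) = bSym2p := by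
  funext j
  by_cases hj : j = 1
  · subst hj; simp [bSym2, bSym2p]
  · rw [Function.update_of_ne hj]; simp [bSym2, bSym2p, hj]

/-- Partial-fraction data of `R_{(6;2⁷)}(t) = (2t+8)(t+1)(t+2)(t+6)(t+7)/((t+3)(t+4)(t+5))^6`. -/
def cSym2 : ℕ → ℕ → ℚ := fun o p =>
  if o = 0 ∧ p = 2 then -679 else
  if o = 0 ∧ p = 3 then 1358 else
  if o = 0 ∧ p = 4 then -679 else
  if o = 1 ∧ p = 2 then 37331/128 else
  if o = 1 ∧ p = 4 then -37331/128 else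
  if o = 2 ∧ p = 2 then -6867/64 else
  if o = 2 ∧ p = 3 then 406 else
  if o = 2 ∧ p = 4 then -6867/64 else
  if o = 3 ∧ p = 2 then 1015/32 else
  if o = 3 ∧ p = 4 then -1015/32 else
  if o = 4 ∧ p = 2 then -107/16 else
  if o = 4 ∧ p = 3 then 72 else
  if o = 4 ∧ p = 4 then -107/16 else
  if o = 5 ∧ p = 2 then 3/4 else
  if o = 5 ∧ p = 4 then -3/4 else
  0

/-- Partial-fraction data of `R_{(6;3,2⁶)}(t) = (2t+8)(t+1)(t+2)(t+6)(t+7)/((t+3)^5(t+4)^6(t+5)^5)`. -/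
def cSym2p : ℕ → ℕ → ℚ := fun o p =>
  if o = 0 ∧ p = 2 then 476 else
  if o = 0 ∧ p = 3 then -952 else
  if o = 0 ∧ p = 4 then 476 else
  if o = 1 ∧ p = 2 then -1463/8 else
  if o = 1 ∧ p = 4 then 1463/8 else
  if o = 2 ∧ p = 2 then 227/4 else
  if o = 2 ∧ p = 3 then -334 else
  if o = 2 ∧ p = 4 then 227/4 else
  if o = 3 ∧ p = 2 then -101/8 else
  if o = 3 ∧ p = 4 then 101/8 else
  if o = 4 ∧ p = 2 then 3/2 else
  if o = 4 ∧ p = 3 then -72 else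
  if o = 4 ∧ p = 4 then 3/2 else
  0

/-- `(t+1)_7 = (t+1)(t+2)⋯(t+7)`. -/
theorem poch_seven (t : ℚ) : Literature.NumberTheory.Transcendental.BallRivoal.poch (t + 1) 7 =
    (t + 1) * (t + 2) * (t + 3) * (t + 4) * (t + 5) * (t + 6) * (t + 7) := by
  simp [Literature.NumberTheory.Transcendental.BallRivoal.poch, prod_range_succ]
  ring

/-- `numPoly_{(6;2⁷)}(t+1) = (2t+8)((t+1)(t+2)(t+6)(t+7))^7`. -/
theorem eval_numPoly_bSym2 (t : ℚ) :
    ((numPoly bSym2).comp (X + C 1)).eval t = (2 * t + 8) * ((t + 1) * (t + 2) * ((t + 6) * (t + 7))) ^ 7 := by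
  rw [eval_comp, eval_add, eval_X, eval_C, eval_numPoly]
  simp [bSym2, prod_range_succ, Literature.NumberTheory.Transcendental.BallRivoal.poch]
  ring

/-- `numPoly_{(6;3,2⁶)}(t+1) = (2t+8)(t+1)(t+2)(t+3)(t+5)(t+6)(t+7)((t+1)(t+2)(t+6)(t+7))^6`. -/
theorem eval_numPoly_bSym2p (t : ℚ) :
    ((numPoly bSym2p).comp (X + C 1)).eval t =
      (2 * t + 8) * ((t + 1) * (t + 2) * (t + 3) * ((t + 5) * (t + 6) * (t + 7))) *
        ((t + 1) * (t + 2) * ((t + 6) * (t + 7))) ^ 6 := by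
  rw [eval_comp, eval_add, eval_X, eval_C, eval_numPoly]
  simp [bSym2p, prod_range_succ, Literature.NumberTheory.Transcendental.BallRivoal.poch]
  ring

/-- `cSym2` is the partial-fraction data of `R_{(6;2⁷)}`. -/
theorem isPFData_bSym2 : IsPFData bSym2 cSym2 := by
  intro t ht
  have hB : (bSym2 0).toNat = 6 := by decide
  rw [hB] at ht ⊢
  have h1 : t + 1 ≠ 0 := by have := ht 0 (by norm_num); simpa using this
  have h2 : t + 2 ≠ 0 := by have := ht 1 (by norm_num); intro h; apply this; push_cast; linarith
  have h3 : t + 3 ≠ 0 := by have := ht 2 (by norm_num); intro h; apply this; push_cast; linarith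
  have h4 : t + 4 ≠ 0 := by have := ht 3 (by norm_num); intro h; apply this; push_cast; linarith
  have h5 : t + 5 ≠ 0 := by have := ht 4 (by norm_num); intro h; apply this; push_cast; linarith
  have h6 : t + 6 ≠ 0 := by have := ht 5 (by norm_num); intro h; apply this; push_cast; linarith
  have h7 : t + 7 ≠ 0 := by have := ht 6 (by norm_num); intro h; apply this; push_cast; linarith
  rw [eval_numPoly_bSym2, poch_seven]
  simp only [pfEval, sum_range_succ, sum_range_zero, cSym2]
  norm_num
  rw [show t + 2 + 1 = t + 3 by ring, show t + 3 + 1 = t + 4 by ring, show t + 4 + 1 = t + 5 by ring]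
  field_simp
  ring

/-- `cSym2p` is the partial-fraction data of `R_{(6;3,2⁶)}`. -/
theorem isPFData_bSym2p : IsPFData bSym2p cSym2p := by
  intro t ht
  have hB : (bSym2p 0).toNat = 6 := by decide
  rw [hB] at ht ⊢
  have h1 : t + 1 ≠ 0 := by have := ht 0 (by norm_num); simpa using this
  have h2 : t + 2 ≠ 0 := by have := ht 1 (by norm_num); intro h; apply this; push_cast; linarith
  have h3 : t + 3 ≠ 0 := by have := ht 2 (by norm_num); intro h; apply this; push_cast; linarith
  have h4 : t + 4 ≠ 0 := by have := ht 3 (by norm_num); intro h; apply this; push_cast; linarith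
  have h5 : t + 5 ≠ 0 := by have := ht 4 (by norm_num); intro h; apply this; push_cast; linarith
  have h6 : t + 6 ≠ 0 := by have := ht 5 (by norm_num); intro h; apply this; push_cast; linarith
  have h7 : t + 7 ≠ 0 := by have := ht 6 (by norm_num); intro h; apply this; push_cast; linarith
  rw [eval_numPoly_bSym2p, poch_seven]
  simp only [pfEval, sum_range_succ, sum_range_zero, cSym2p]
  norm_num
  rw [show t + 2 + 1 = t + 3 by ring, show t + 3 + 1 = t + 4 by ring, show t + 4 + 1 = t + 5 by ring]
  field_simp
  ring

/-- `U(6;2⁷) = 469/8`, `W(6;2⁷) = 6125/32`. -/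
theorem coeff_bSym2 : coeffU bSym2 = 469 / 8 ∧ coeffW bSym2 = 6125 / 32 := by
  have hB : (bSym2 0).toNat = 6 := by decide
  refine ⟨?_, ?_⟩
  · rw [coeffU_eq isPFData_bSym2, hB]; simp only [sum_range_succ, sum_range_zero, cSym2]; norm_num
  · rw [coeffW_eq isPFData_bSym2, hB]; simp only [sum_range_succ, sum_range_zero, cSym2]; norm_num

/-- `U(6;3,2⁶) = −69`, `W(6;3,2⁶) = −441/2`. -/
theorem coeff_bSym2p : coeffU bSym2p = -69 ∧ coeffW bSym2p = -441 / 2 := by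
  have hB : (bSym2p 0).toNat = 6 := by decide
  refine ⟨?_, ?_⟩
  · rw [coeffU_eq isPFData_bSym2p, hB]; simp only [sum_range_succ, sum_range_zero, cSym2p]; norm_num
  · rw [coeffW_eq isPFData_bSym2p, hB]; simp only [sum_range_succ, sum_range_zero, cSym2p]; norm_num

/-- `Q(2⁸) = 2989` (Brown–Zudilin §2, `Q₂`), by the kernel from (17). -/
theorem QOf_twos : QOf ![2, 2, 2, 2, 2, 2, 2, 2] = 2989 := by decide

/-- `ρ(2⁸) = 32/3`. -/
theorem rhoOf_twos : rhoOf ![2, 2, 2, 2, 2, 2, 2, 2] = 32 / 3 := by decide +kernel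

/-- **INSTANCE of the `Q`-identity of `wedgeDictionary` at `a = 2⁸`, partner `j = 1`**:
`Q(2⁸) = 2989 = (32/3)·((469/8)(−441/2) − (−69)(6125/32))`. -/
theorem Q_identity_twos :
    let b := bOfA ![2, 2, 2, 2, 2, 2, 2, 2]
    let b' := Function.update b 1 (b 1 + 1)
    (QOf ![2, 2, 2, 2, 2, 2, 2, 2] : ℚ) =
      rhoOf ![2, 2, 2, 2, 2, 2, 2, 2] * (coeffU b * coeffW b' - coeffU b' * coeffW b) := by
  simp only [bOfA_twos, update_bSym2]
  rw [QOf_twos, rhoOf_twos, coeff_bSym2.1, coeff_bSym2.2, coeff_bSym2p.1, coeff_bSym2p.2]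
  norm_num

/-- `a = 2⁸` lies in the region of the conjecture with partner `j = 1`. -/
theorem region_twos :
    Converges ![2, 2, 2, 2, 2, 2, 2, 2] ∧
      (∀ i ∈ Icc 1 7, 0 ≤ bOfA ![2, 2, 2, 2, 2, 2, 2, 2] i ∧
        2 * bOfA ![2, 2, 2, 2, 2, 2, 2, 2] i ≤ bOfA ![2, 2, 2, 2, 2, 2, 2, 2] 0 + 1) ∧
      0 ≤ dOf (bOfA ![2, 2, 2, 2, 2, 2, 2, 2]) ∧
      2 * (bOfA ![2, 2, 2, 2, 2, 2, 2, 2] 1 + 1) ≤ bOfA ![2, 2, 2, 2, 2, 2, 2, 2] 0 + 1 :=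
  ⟨by decide, by decide, by decide, by decide⟩

end Summit.KontsevichZagierPeriods.Zeta5Search.WedgeDictionary
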